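import Summits.Ventures.HodgeRepro.Tier3GaloisDescent

/-!
# The rational Hodge class of an orbit of Pohlmann sets — LEMMA-R-RESIDUE.md §5 (i)–(iii) on the kernel

Blind re-derivation cell `pub-hodge-repro`, seat `t3-p4` (Tier 3, T3.5 for T3.4).  Target tree path
`lean/Summits/Ventures/HodgeRepro/Tier3OrbitDescent.lean`; imports Mathlib and the cell's `Tier3GaloisDescent`.

LEMMA-R-RESIDUE.md v5 §5 builds the rational Hodge class `η` of `B_red` as follows: in a `Gal(F/ℚ)`-EQUIVARIANT
`F`-basis `{e_U}` of `H^{2p}(B_red, ℚ) ⊗_ℚ F` (coordinate wedges, `(τ ⊗ 1) e_U = e_{τ∘U}`), `η := Σ_{U ∈ G·U_{σ₀}} e_U`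
is the sum over the DISTINCT sets of the Galois orbit of one reduced (Pohlmann) set; then (i) `η ≠ 0`, (ii) `η` is
Galois-fixed hence `η = 1 ⊗ v` with `v` rational (descent of invariant vectors, `exists_tmul_of_forall_rTensor_eq`),
(iii) `v ∈ B^p(B_red)` because every `e_U` of the orbit lies in `B^p ⊗ F` (Pohlmann) and `(B^p ⊗ F) ∩ (H^{2p}(ℚ) ⊗ 1) = B^p`.

This file proves (i)–(iii) for an arbitrary vector space `V` over a field `F₀`, a finite Galois extension `K/F₀`, a
`K`-basis `e` of `K ⊗[F₀] V` indexed by a set `ι` with a `Gal(K/F₀)`-action such that `(σ ⊗ 1) e_U = e_{σ • U}`, and an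
`F₀`-subspace `W ≤ V` together with a Galois-stable set `P ⊆ ι` of indices whose basis vectors lie in `W ⊗ K`:
`exists_rational_orbit_sum` — for `U₀ ∈ P` the orbit sum `Σ_{U ∈ G • U₀} e_U` equals `1 ⊗ v` for a NON-ZERO `v ∈ W`.
The step `1 ⊗ v ∈ W ⊗ K ⇒ v ∈ W` is `tmul_one_mem_baseChange_iff` (Mathlib's `Submodule.baseChange_le_iff` for the
faithfully flat extension `K/F₀` — Milne 2020 arXiv:2010.08857 p0005:L74–80's footnote «if `W ⊗_k K ⊂ W′ ⊗_k K` then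
`W ⊂ W′`» is `subspace_le_of_baseChange_le` below).  Applied with `F₀ = ℚ`, `K = F` (the Galois CM field),
`V = H^{2p}(B_red, ℚ)`, `W = B^p(B_red)`, `P` = the Pohlmann sets, `U₀ = U_{σ₀}`.

HONESTY.  Linear algebra on Mathlib; the existence of the equivariant eigenbasis and the identification of `W` with the
Hodge classes are the note's PRINTED inputs (Deligne LNM 900 p0030:L23–36; Pohlmann via Milne 2020 p0003:L68–82) and
stay on paper.  HC_CM is NOT proved by anyone in this repository.
-/

set_option autoImplicit false

open TensorProduct

namespace HodgeRepro.Tier3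

variable {F₀ K : Type*} [Field F₀] [Field K] [Algebra F₀ K]
variable {V : Type*} [AddCommGroup V] [Module F₀ V]

/-- Milne 2020's footnote (p0005:L74–80): `F₀`-subspaces of `V` are compared by their base changes to `K` —
`W.baseChange K ≤ W'.baseChange K` implies `W ≤ W'` (Mathlib `Submodule.baseChange_le_iff`; the extension `K/F₀` is
faithfully flat since `K` is a non-zero free `F₀`-module). -/
theorem subspace_le_of_baseChange_le {W W' : Submodule F₀ V}
    (h : W.baseChange K ≤ W'.baseChange K) : W ≤ W' :=
  (Submodule.baseChange_le_iff (A := K)).mp h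

/-- An `F₀`-subspace is determined by its base change: `W.baseChange K = W'.baseChange K → W = W'`. -/
theorem subspace_eq_of_baseChange_eq {W W' : Submodule F₀ V}
    (h : W.baseChange K = W'.baseChange K) : W = W' :=
  Submodule.baseChange_injective h

/-- `(W ⊗ K) ∩ (V ⊗ 1) = W`: a rational vector whose image `1 ⊗ v` lies in `W.baseChange K` lies in `W`. -/
theorem tmul_one_mem_baseChange_iff (W : Submodule F₀ V) (v : V) :
    (1 : K) ⊗ₜ[F₀] v ∈ W.baseChange K ↔ v ∈ W := by
  constructor
  · intro h
    have h1 : (Submodule.span F₀ {v}).baseChange K ≤ W.baseChange K := by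
      rw [Submodule.baseChange_span, Submodule.span_le]
      rintro _ ⟨x, hx, rfl⟩
      rw [Set.mem_singleton_iff] at hx
      subst hx
      exact h
    exact subspace_le_of_baseChange_le h1 (Submodule.mem_span_singleton_self v)
  · exact fun h => Submodule.tmul_mem_baseChange_of_mem 1 h

section OrbitSum

variable {ι G : Type*} [Group G] [MulAction G ι]

/-- A finite set `S` that enumerates the `G`-orbit of `U₀` (`U ∈ S ↔ ∃ σ, σ • U₀ = U`) is stable under every
`σ ∈ G`: `S.image (σ • ·) = S`. -/
theorem image_smul_eq_self_of_orbit [DecidableEq ι] {U₀ : ι} {S : Finset ι}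
    (hS : ∀ U, U ∈ S ↔ ∃ σ : G, σ • U₀ = U) (σ : G) : S.image (fun U => σ • U) = S := by
  ext U
  simp only [Finset.mem_image, hS]
  constructor
  · rintro ⟨U', ⟨τ, rfl⟩, rfl⟩
    exact ⟨σ * τ, mul_smul σ τ U₀⟩
  · rintro ⟨τ, rfl⟩
    exact ⟨σ⁻¹ • τ • U₀, ⟨σ⁻¹ * τ, mul_smul _ _ _⟩, by rw [smul_smul, mul_inv_cancel, one_smul]⟩

/-- `U₀` belongs to any enumeration of its orbit. -/
theorem self_mem_of_orbit {U₀ : ι} {S : Finset ι} (hS : ∀ U, U ∈ S ↔ ∃ σ : G, σ • U₀ = U) : U₀ ∈ S :=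
  (hS U₀).mpr ⟨1, one_smul _ _⟩

/-- The orbit `{σ • U₀ : σ ∈ G}` of a FINITE group, as the finset `Finset.univ.image (· • U₀)`. -/
theorem mem_image_univ_smul_iff [DecidableEq ι] [Fintype G] {U₀ U : ι} :
    U ∈ Finset.univ.image (fun σ : G => σ • U₀) ↔ ∃ σ : G, σ • U₀ = U := by
  simp

end OrbitSum

section Orbit

variable {ι : Type*} [MulAction (K ≃ₐ[F₀] K) ι]

/-- The sum `Σ_{U ∈ S} e_U` over an enumeration `S` of the `Gal(K/F₀)`-orbit of `U₀` of a Galois-equivariant basis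
`e` (`(σ ⊗ 1) e_U = e_{σ • U}`) is fixed by every `σ ⊗ 1`. -/
theorem rTensor_sum_eq_of_orbit (e : Module.Basis ι K (K ⊗[F₀] V))
    (hequiv : ∀ (σ : K ≃ₐ[F₀] K) (U : ι), LinearMap.rTensor V σ.toLinearMap (e U) = e (σ • U))
    {U₀ : ι} {S : Finset ι} (hS : ∀ U, U ∈ S ↔ ∃ σ : K ≃ₐ[F₀] K, σ • U₀ = U) (σ : K ≃ₐ[F₀] K) :
    LinearMap.rTensor V σ.toLinearMap (∑ U ∈ S, e U) = ∑ U ∈ S, e U := by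
  classical
  rw [map_sum]
  simp only [hequiv]
  conv_rhs => rw [← image_smul_eq_self_of_orbit hS σ]
  rw [Finset.sum_image]
  intro x _ y _ hxy
  exact (MulAction.injective σ) hxy

omit [MulAction (K ≃ₐ[F₀] K) ι] in
/-- The coordinate at `U₀ ∈ S` of the sum `Σ_{U ∈ S} e_U` of distinct basis vectors is `1`. -/
theorem repr_sum_basis_self (e : Module.Basis ι K (K ⊗[F₀] V)) {U₀ : ι} {S : Finset ι} (hU₀ : U₀ ∈ S) :
    e.repr (∑ U ∈ S, e U) U₀ = 1 := by
  classical
  rw [map_sum, Finsupp.finsetSum_apply]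
  simp only [Module.Basis.repr_self, Finsupp.single_apply]
  rw [Finset.sum_ite_eq' S U₀ (fun _ => (1 : K))]
  simp [hU₀]

omit [MulAction (K ≃ₐ[F₀] K) ι] in
/-- A sum of distinct basis vectors over a non-empty index set is non-zero. -/
theorem sum_basis_ne_zero (e : Module.Basis ι K (K ⊗[F₀] V)) {U₀ : ι} {S : Finset ι} (hU₀ : U₀ ∈ S) :
    (∑ U ∈ S, e U) ≠ 0 := by
  intro h
  have := repr_sum_basis_self e hU₀
  rw [h, map_zero, Finsupp.zero_apply] at this
  exact zero_ne_one this

variable [IsGalois F₀ K] [FiniteDimensional F₀ K]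

/-- **The rational class of an orbit of Pohlmann sets** (LEMMA-R-RESIDUE.md §5 (i)–(iii)).  Let `e` be a `K`-basis of
`K ⊗[F₀] V` that is `Gal(K/F₀)`-equivariant (`(σ ⊗ 1) e_U = e_{σ • U}`), `W ≤ V` an `F₀`-subspace and `P ⊆ ι` a
Galois-stable set of indices with `e_U ∈ W ⊗ K` for every `U ∈ P`.  Then for every `U₀ ∈ P` and every finite
enumeration `S` of the orbit of `U₀` (`U ∈ S ↔ ∃ σ, σ • U₀ = U` — the DISTINCT sets `σ∘U₀`), the orbit sum
`Σ_{U ∈ S} e_U` is `1 ⊗ v` for a NON-ZERO `v ∈ W`. -/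
theorem exists_rational_orbit_sum (e : Module.Basis ι K (K ⊗[F₀] V))
    (hequiv : ∀ (σ : K ≃ₐ[F₀] K) (U : ι), LinearMap.rTensor V σ.toLinearMap (e U) = e (σ • U))
    (W : Submodule F₀ V) (P : Set ι) (hP : ∀ (σ : K ≃ₐ[F₀] K), ∀ U ∈ P, σ • U ∈ P)
    (hPW : ∀ U ∈ P, e U ∈ W.baseChange K) {U₀ : ι} (hU₀ : U₀ ∈ P) {S : Finset ι}
    (hS : ∀ U, U ∈ S ↔ ∃ σ : K ≃ₐ[F₀] K, σ • U₀ = U) :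
    ∃ v : V, v ∈ W ∧ v ≠ 0 ∧ (1 : K) ⊗ₜ[F₀] v = ∑ U ∈ S, e U := by
  obtain ⟨v, hv⟩ := exists_tmul_of_forall_rTensor_eq (∑ U ∈ S, e U)
    (fun σ => rTensor_sum_eq_of_orbit e hequiv hS σ)
  refine ⟨v, ?_, ?_, hv.symm⟩
  · rw [← tmul_one_mem_baseChange_iff (K := K), ← hv]
    refine Submodule.sum_mem _ fun U hU => ?_
    obtain ⟨σ, rfl⟩ := (hS U).mp hU
    exact hPW _ (hP σ U₀ hU₀)
  · rintro rfl
    exact sum_basis_ne_zero e (self_mem_of_orbit hS) (by rw [hv, TensorProduct.tmul_zero])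

/-- `exists_rational_orbit_sum` with the orbit enumerated as `Finset.univ.image (· • U₀)` over the finite Galois
group: `Σ_{U ∈ G • U₀} e_U = 1 ⊗ v`, `v ∈ W`, `v ≠ 0`. -/
theorem exists_rational_orbit_sum' [DecidableEq ι] (e : Module.Basis ι K (K ⊗[F₀] V))
    (hequiv : ∀ (σ : K ≃ₐ[F₀] K) (U : ι), LinearMap.rTensor V σ.toLinearMap (e U) = e (σ • U))
    (W : Submodule F₀ V) (P : Set ι) (hP : ∀ (σ : K ≃ₐ[F₀] K), ∀ U ∈ P, σ • U ∈ P)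
    (hPW : ∀ U ∈ P, e U ∈ W.baseChange K) {U₀ : ι} (hU₀ : U₀ ∈ P) :
    ∃ v : V, v ∈ W ∧ v ≠ 0 ∧
      (1 : K) ⊗ₜ[F₀] v = ∑ U ∈ Finset.univ.image (fun σ : K ≃ₐ[F₀] K => σ • U₀), e U :=
  exists_rational_orbit_sum e hequiv W P hP hPW hU₀ fun _ => mem_image_univ_smul_iff

end Orbit

end HodgeRepro.Tier3
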